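import Summits.MatrixMultiplication.OmegaCensus.SmallFormats.MatMul22nRankGF7Slack6Search
import Summits.MatrixMultiplication.OmegaCensus.SmallFormats.MatMul22nRankGF7PackW
import HarnessLib

/-!
# ω-census family (a): flat (run-time packed) accessors for the slack-6 tables — family `misc` (file 7 of 7)

Cell `pub-omega` (unit `pub-omega-tensor-g18`), topic `Summits/MatrixMultiplication/OmegaCensus` (sub-folder `SmallFormats`).
Framing (verbatim): lottery ticket; floor = certified bounds/negative ranges. HONEST FRAMING: kernel bookkeeping only
(`pub-omega-tensor-g18/code/py/gen6_flat.py`, KERNEL-S6-SPLIT.md §7). Each landed page table (`match` on numerals, 0.63 ms per access in the kernel)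
is packed ONCE per declaration into a single number `…Flat := packW (w·per) …Page n` and read by two nested field extractions (≈ 0.1-0.2 ms per access);
every flat accessor is PROVED EQUAL to the landed one (`…F_eq`, from `fld_packW`). Nothing here is progress on `ω`.
-/

namespace Summit.MatrixMultiplication.OmegaCensus.SmallFormats

/-- `clsByNeed6Page` packed into one number (6 pages of `8184` bits; evaluated once per declaration). -/
def clsByNeed6Flat : ℕ := packW 8184 clsByNeed6Page 6

/-- The pages of `clsByNeed6Page` are `8184`-bit. -/
theorem clsByNeed6Page_lt : ∀ k < 6, clsByNeed6Page k < 2 ^ 8184 := by decide +kernel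

/-- Flat form of `clsByNeed6`. -/
def clsByNeed6F (i : ℕ) : ℕ := if i < 4092 then fld 12 (fld 8184 clsByNeed6Flat (i / 682)) (i % 682) else clsByNeed6 i

/-- `clsByNeed6F = clsByNeed6`. -/
theorem clsByNeed6F_eq : clsByNeed6F = clsByNeed6 := by
  funext i; unfold clsByNeed6F
  split_ifs with h
  · unfold clsByNeed6 clsByNeed6Flat; rw [fld_packW clsByNeed6Page clsByNeed6Page_lt, if_pos (by omega)]
  · rfl

/-- `nkoff6Page` packed into one number (5 pages of `8184` bits; evaluated once per declaration). -/
def nkoff6Flat : ℕ := packW 8184 nkoff6Page 5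

/-- The pages of `nkoff6Page` are `8184`-bit. -/
theorem nkoff6Page_lt : ∀ k < 5, nkoff6Page k < 2 ^ 8184 := by decide +kernel

/-- Flat form of `nkoff6`. -/
def nkoff6F (i : ℕ) : ℕ := if i < 3410 then fld 12 (fld 8184 nkoff6Flat (i / 682)) (i % 682) else nkoff6 i

/-- `nkoff6F = nkoff6`. -/
theorem nkoff6F_eq : nkoff6F = nkoff6 := by
  funext i; unfold nkoff6F
  split_ifs with h
  · unfold nkoff6 nkoff6Flat; rw [fld_packW nkoff6Page nkoff6Page_lt, if_pos (by omega)]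
  · rfl

/-- `rep6Page` packed into one number (58 pages of `8192` bits; evaluated once per declaration). -/
def repPack6Flat : ℕ := packW 8192 rep6Page 58

/-- The pages of `rep6Page` are `8192`-bit. -/
theorem rep6Page_lt : ∀ k < 58, rep6Page k < 2 ^ 8192 := by decide +kernel

/-- Flat form of `repPack6`. -/
def repPack6F (i : ℕ) : ℕ := if i < 3712 then fld 128 (fld 8192 repPack6Flat (i / 64)) (i % 64) else repPack6 i

/-- `repPack6F = repPack6`. -/
theorem repPack6F_eq : repPack6F = repPack6 := by
  funext i; unfold repPack6F
  split_ifs with h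
  · unfold repPack6 repPack6Flat; rw [fld_packW rep6Page rep6Page_lt, if_pos (by omega)]
  · rfl

end Summit.MatrixMultiplication.OmegaCensus.SmallFormats
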